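import Summits.AtomisticToContinuum.HydrodynamicLimit.Theorems.AnnealedZeroHorizonMeanFluxClosureCollisionalEnergyContactClosure
import HarnessLib

/-!
# Stub CE' `stub_collisionalEnergyContactClosure` of crux `MeanFluxClosure`
# (stmt-AtomisticToContinuum-9256, route AnnealedZeroHorizon, line `registered`): EOS-free part B —
# in equilibrium the contact energy current has mean exactly zero

Companion of `AnnealedZeroHorizonMeanFluxClosureCollisionalEnergyContactClosure.lean` (part A). For
CONSTANT profiles `a₀ ≡ a > 0`, `u₀ ≡ u`, `θ₀ ≡ θ > 0` (`0 < σ < 1/2`), every `N`, every flow, every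
window `0 ≤ t₁ ≤ t₂` and every smooth `ψ`, the contact energy current `c S^e_ψ ∘ Φ_{t₁}` of stub CE'
(kernel `½ Dψ(x_i)(x_i ⊖ x_j) ΔE_i`) is integrable under the homogeneous local Gibbs law `G_N` with
mean EXACTLY `0` (`integral_avg_contactEnergyCurrent_eq_zero_const`, registered ∀-form
`stub_collisionalEnergyContactEquilibrium`). Proof = translation averaging: by part A the mean of
`c S^e_{ψ(·+y)} ∘ Φ_{t₁}` does not depend on `y ∈ 𝕋³`; average over `y` (Haar probability), swap the
integrals (ONE Fubini on `𝕋³ × Config`: the integrand is jointly measurable — continuous in `y` as a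
finite collision sum, measurable in the datum — and dominated by `(‖Dψ‖_∞/2 + ‖D²ψ‖_∞ σ_N/4) Q`, `Q` the
integrable FLUX functional), and use that for a good datum the `y`-average of the finite collision sum
vanishes term by term: `∫_{𝕋³} Dψ(x_i + y)(n) dy = ∫_{𝕋³} Dψ(y)(n) dy = 0` (`∫_{𝕋³} ∂_v ψ = 0`).
So at constant profiles stub CE' is EXACTLY the closure in mean of `J^e_ψ − I^e_ψ` (the EOS part).
(Sanity: with `u ≠ 0` the equilibrium collisional energy current `p_coll u` is a nonzero CONSTANT
vector, whose pairing with `∇ψ` integrates to zero.) No definitions.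

References: H. Spohn, *Large Scale Dynamics of Interacting Particles* (1991), Part I §2.3, §3.2 (3.8), (3.15).
-/

noncomputable section

namespace Summit.AtomisticToContinuum.HydrodynamicLimit.Theorems

open scoped BigOperators ENNReal Topology InnerProductSpace
open MeasureTheory Set Filter Function
open Literature.MathematicalPhysics.KineticTheory Literature.Analysis.FluidPDE
open Literature.Analysis.FunctionSpaces
open Summit.AtomisticToContinuum.HydrodynamicLimit.Theorems.JParityClosureMomentumModulus
open Summit.AtomisticToContinuum.HydrodynamicLimit.Theorems.JParityClosureEnergyModulus
open Summit.AtomisticToContinuum.HydrodynamicLimit.Theorems.CollisionalEnergyCurrentClosure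
open Summit.AtomisticToContinuum.HydrodynamicLimit.Theorems.CollisionEnergyExchangeMeanBound

namespace CollisionalEnergyContactClosure

/-! ## The `y`-average of the translated contact functional vanishes -/

/-- `∫_{𝕋³} Dψ(y)(v) dy = 0` for smooth `ψ` and every direction `v` (`Dψ(y)(v) = ∂_v ψ(y)` and
`∫_{𝕋³} ∂_v ψ = 0`, empty boundary). [folklore] -/
theorem integral_torusFderiv_apply_eq_zero {ψ : T3 → ℝ} (hψ : Torus.IsSmooth ψ) (v : V3) :
    ∫ y, Torus.fderiv ψ y v = 0 := by
  have h1 : Torus.IsContDiff 1 ψ := hψ.isContDiff (by simp)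
  simp_rw [← Torus.lineDeriv_eq_fderiv_apply h1]
  exact Torus.integral_lineDeriv_eq_zero hψ v

/-- `∫_{𝕋³} Dψ(x + y)(v) dy = 0` (translation invariance of the Haar measure). [folklore] -/
theorem integral_torusFderiv_add_apply_eq_zero {ψ : T3 → ℝ} (hψ : Torus.IsSmooth ψ) (x : T3)
    (v : V3) : ∫ y, Torus.fderiv ψ (x + y) v = 0 :=
  (integral_add_left_eq_self (μ := (volume : Measure T3)) (fun x' => Torus.fderiv ψ x' v) x).trans
    (integral_torusFderiv_apply_eq_zero hψ v)

/-- **Finite-sum form of the translated contact functional** on a good datum: the contact energy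
current for the translated test function `ψ(· + y)` over `(0, τ]` is the finite sum over the collision
times in `(0, τ]` and the colliding ordered pairs of `½ Dψ(x_i + y)(x_i ⊖ x_j) ΔE_i`. [folklore] -/
theorem contactEnergyFunctional_shift_eq_sum {ε : ℝ} {n : ℕ}
    (Φ : HardSphereFlow (Torus.geometry (Fin 3)) ε n) (ψ : T3 → ℝ) {w : Config n (Fin 3) T3}
    (hw : w ∈ Φ.good) (τ : ℝ) (y : T3) :
    Φ.collisionalTransferFunctional
        (fun (i j : Fin n) (pre post : Config n (Fin 3) T3) =>
          2⁻¹ * (Torus.fderiv (fun x => ψ (x + y)) (post i).1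
            ((Torus.geometry (Fin 3)).sepVec (post i).1 (post j).1) *
            ((‖(post i).2‖ ^ 2 - ‖(pre i).2‖ ^ 2) / 2))) w τ =
      ∑ t ∈ ((Φ.isTrajectory w hw).finite_collisionTimes_inter_Ioc 0 τ).toFinset,
        ∑ p ∈ collidingPairs (Torus.geometry (Fin 3)) ε (Φ.flow t w),
          2⁻¹ * (Torus.fderiv ψ ((Φ.flow t w p.1).1 + y)
            ((Torus.geometry (Fin 3)).sepVec (Φ.flow t w p.1).1 (Φ.flow t w p.2).1) *
            ((‖(Φ.flow t w p.1).2‖ ^ 2 - ‖(leftLim (fun s => Φ.flow s w) t p.1).2‖ ^ 2) / 2)) := by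
  rw [HardSphereFlow.collisionalTransferFunctional_eq,
    collisionalTransferFunctional_eq_sum _ ((Φ.isTrajectory w hw).finite_collisionTimes_inter_Ioc 0 τ)]
  simp only [torusFderiv_comp_add_right]

/-- **The `y`-average of the translated contact functional vanishes** on every good datum:
`∫_{𝕋³} S^e_{ψ(·+y)}(w; (0, τ]) dy = 0` — a finite sum of `½ (∫_{𝕋³} Dψ(x_i + y)(x_i ⊖ x_j) dy) ΔE_i = 0`.
[folklore] -/
theorem integral_contactEnergyFunctional_shift_eq_zero {ε : ℝ} {n : ℕ}
    (Φ : HardSphereFlow (Torus.geometry (Fin 3)) ε n) {ψ : T3 → ℝ} (hψ : Torus.IsSmooth ψ)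
    {w : Config n (Fin 3) T3} (hw : w ∈ Φ.good) (τ : ℝ) :
    ∫ y, Φ.collisionalTransferFunctional
        (fun (i j : Fin n) (pre post : Config n (Fin 3) T3) =>
          2⁻¹ * (Torus.fderiv (fun x => ψ (x + y)) (post i).1
            ((Torus.geometry (Fin 3)).sepVec (post i).1 (post j).1) *
            ((‖(post i).2‖ ^ 2 - ‖(pre i).2‖ ^ 2) / 2))) w τ = 0 := by
  have hD := Torus.continuous_fderiv (hψ.isContDiff (n := 1) (by simp))
  simp_rw [contactEnergyFunctional_shift_eq_sum Φ ψ hw τ]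
  have hcont : ∀ (t : ℝ) (p : Fin n × Fin n), Continuous fun y : T3 =>
      2⁻¹ * (Torus.fderiv ψ ((Φ.flow t w p.1).1 + y)
        ((Torus.geometry (Fin 3)).sepVec (Φ.flow t w p.1).1 (Φ.flow t w p.2).1) *
        ((‖(Φ.flow t w p.1).2‖ ^ 2 - ‖(leftLim (fun s => Φ.flow s w) t p.1).2‖ ^ 2) / 2)) :=
    fun t p => continuous_const.mul (((hD.comp (continuous_const.add continuous_id)).clm_apply
      continuous_const).mul continuous_const)
  rw [integral_finsetSum _ fun t _ => integrable_finsetSum _ fun p _ =>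
    integrable_of_continuous_T3 (hcont t p)]
  refine Finset.sum_eq_zero fun t _ => ?_
  rw [integral_finsetSum _ fun p _ => integrable_of_continuous_T3 (hcont t p)]
  refine Finset.sum_eq_zero fun p _ => ?_
  rw [integral_const_mul, integral_mul_const, integral_torusFderiv_add_apply_eq_zero hψ, zero_mul,
    mul_zero]

/-- **Joint measurability of the translated contact functional** in (shift, datum): the map
`(y, w) ↦ 𝟙_{good}(w) S^e_{ψ(·+y)}(w; (0, τ])` is strongly measurable on `𝕋³ × Config` — continuous in `y`
for each `w` (a finite collision sum of `½ Dψ(x_i + y)(n) ΔE_i`, `Dψ` continuous) and measurable in `w`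
for each `y` (`measurable_indicator_contactFunctional`). [folklore] -/
theorem stronglyMeasurable_contactEnergyFunctional_shift {ε : ℝ} (hε : ε < 2⁻¹) {n : ℕ}
    (Φ : HardSphereFlow (Torus.geometry (Fin 3)) ε n) {ψ : T3 → ℝ} (hψ : Torus.IsSmooth ψ) (τ : ℝ) :
    StronglyMeasurable (Function.uncurry fun (y : T3) (w : Config n (Fin 3) T3) =>
      Φ.good.indicator (fun w => Φ.collisionalTransferFunctional
        (fun (i j : Fin n) (pre post : Config n (Fin 3) T3) =>
          2⁻¹ * (Torus.fderiv (fun x => ψ (x + y)) (post i).1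
            ((Torus.geometry (Fin 3)).sepVec (post i).1 (post j).1) *
            ((‖(post i).2‖ ^ 2 - ‖(pre i).2‖ ^ 2) / 2))) w τ) w) := by
  have hD := Torus.continuous_fderiv (hψ.isContDiff (n := 1) (by simp))
  refine stronglyMeasurable_uncurry_of_continuous_of_stronglyMeasurable (fun w => ?_) (fun y => ?_)
  · by_cases hw : w ∈ Φ.good
    · simp only [indicator_of_mem hw, contactEnergyFunctional_shift_eq_sum Φ ψ hw τ]
      exact continuous_finsetSum _ fun t _ => continuous_finsetSum _ fun p _ =>
        continuous_const.mul (((hD.comp (continuous_const.add continuous_id)).clm_apply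
          continuous_const).mul continuous_const)
    · simp only [indicator_of_notMem hw]
      exact continuous_const
  · exact (measurable_indicator_contactFunctional Φ hε
      ((hψ.comp_add_right y).isContDiff (n := 1) (by simp)) τ).stronglyMeasurable

/-! ## Equilibrium: the mean contact energy current vanishes -/

/-- **In equilibrium the contact energy current has mean exactly zero.** For constant profiles
`a, θ > 0`, `u`, `0 < σ < 1/2`, every `N`, every flow `Φ`, `0 ≤ t₁ ≤ t₂` and smooth `ψ`:
`E_{G_N}[c S^e_ψ ∘ Φ_{t₁}] = 0`, `G_N = localGibbsLaw σ a u θ N Φ`. Translation averaging: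
`E[c S^e_ψ] = ∫_y E[c S^e_{ψ(·+y)}] dy = E[c ∫_y S^e_{ψ(·+y)} dy] = E[0]` (shift invariance of part A,
one Fubini against the integrable FLUX domination, and `integral_contactEnergyFunctional_shift_eq_zero`).
[folklore] -/
theorem integral_avg_contactEnergyCurrent_eq_zero_const {σ : ℝ} (hσ : 0 < σ) (hσ2 : σ < 1 / 2)
    {a θ : ℝ} (ha : 0 < a) (hθ : 0 < θ) (u : V3) {N : ℕ}
    (Φ : HardSphereFlow (Torus.geometry (Fin 3)) (hsDiameter σ N) (N + 1)) {ψ : T3 → ℝ}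
    (hψ : Torus.IsSmooth ψ) {t₁ t₂ : ℝ} (h₁ : 0 ≤ t₁) (h₁₂ : t₁ ≤ t₂) :
    ∫ z, ((N + 1 : ℕ) : ℝ)⁻¹ * Φ.collisionalTransferFunctional
        (fun (i j : Fin (N + 1)) (pre post : Config (N + 1) (Fin 3) T3) =>
          2⁻¹ * (Torus.fderiv ψ (post i).1 ((Torus.geometry (Fin 3)).sepVec (post i).1 (post j).1) *
            ((‖(post i).2‖ ^ 2 - ‖(pre i).2‖ ^ 2) / 2))) (Φ.flow t₁ z) (t₂ - t₁)
      ∂(localGibbsLaw σ (fun _ => a) (fun _ => u) (fun _ => θ) N Φ) = 0 := by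
  set G := localGibbsLaw σ (fun _ => a) (fun _ => u) (fun _ => θ) N Φ with hGdef
  haveI : IsProbabilityMeasure G := isProbabilityMeasure_localGibbsLaw continuous_const
    continuous_const continuous_const (fun _ => ha) (fun _ => hθ) hσ2.le N Φ
  have hε : hsDiameter σ N < 2⁻¹ := (hsDiameter_lt_half hσ.le hσ2 N).trans_eq (by norm_num)
  have hc0 : 0 ≤ ((N + 1 : ℕ) : ℝ)⁻¹ := inv_nonneg.2 (Nat.cast_nonneg _)
  have hgood : ∀ᵐ z ∂G, z ∈ Φ.good :=
    (localGibbsLaw_absolutelyContinuous σ _ _ _ N Φ).ae_le Φ.ae_mem_good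
  -- derivative bounds of `ψ` and of its translates
  have h1 : Torus.IsContDiff 1 ψ := hψ.isContDiff (by simp)
  have h2 : Torus.IsContDiff 2 ψ := hψ.isContDiff (WithTop.coe_le_coe.2 le_top)
  obtain ⟨L, -, hL⟩ := exists_fderiv_le h1
  obtain ⟨C, -, hC⟩ := exists_fderiv_fderiv_le h2
  have hDy : ∀ y : T3, Torus.fderiv (fun x => ψ (x + y)) = fun x => Torus.fderiv ψ (x + y) :=
    fun y => funext fun x => torusFderiv_comp_add_right ψ y x
  have hLy : ∀ y x : T3, ‖Torus.fderiv (fun x => ψ (x + y)) x‖ ≤ L := fun y x => by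
    rw [torusFderiv_comp_add_right]; exact hL _
  have hCy : ∀ y x : T3, ‖Torus.fderiv (Torus.fderiv (fun x => ψ (x + y))) x‖ ≤ C := fun y x => by
    rw [hDy, torusFderiv_comp_add_right]; exact hC _
  have h1y : ∀ y : T3, Torus.IsContDiff 1 (fun x => ψ (x + y)) := fun y =>
    (hψ.comp_add_right y).isContDiff (by simp)
  have h2y : ∀ y : T3, Torus.IsContDiff 2 (fun x => ψ (x + y)) := fun y =>
    (hψ.comp_add_right y).isContDiff (WithTop.coe_le_coe.2 le_top)
  -- the FLUX functional `Q = σ_N c 𝒮ᴱ ∘ Φ_{t₁}` is integrable (every `N`)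
  have hQ : Integrable (fun z => hsDiameter σ N * ((N + 1 : ℕ) : ℝ)⁻¹ *
      Φ.collisionalTransferFunctional
        (fun (i _j : Fin (N + 1)) (pre post : Config (N + 1) (Fin 3) T3) =>
          |‖(post i).2‖ ^ 2 - ‖(pre i).2‖ ^ 2| / 2) (Φ.flow t₁ z) (t₂ - t₁)) G :=
    (integrable_absEnergyJumpFunctional_flow continuous_const continuous_const continuous_const
      (fun _ => ha) (fun _ => hθ) hσ (hσ2.le.trans_eq (by norm_num)) Φ h₁ h₁₂).const_mul _
  -- Step 1: the mean of the translated current does not depend on the shift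
  have hshift : ∀ y : T3, ∫ z, ((N + 1 : ℕ) : ℝ)⁻¹ * Φ.collisionalTransferFunctional
      (fun (i j : Fin (N + 1)) (pre post : Config (N + 1) (Fin 3) T3) =>
        2⁻¹ * (Torus.fderiv (fun x => ψ (x + y)) (post i).1
          ((Torus.geometry (Fin 3)).sepVec (post i).1 (post j).1) *
          ((‖(post i).2‖ ^ 2 - ‖(pre i).2‖ ^ 2) / 2))) (Φ.flow t₁ z) (t₂ - t₁) ∂G =
      ∫ z, ((N + 1 : ℕ) : ℝ)⁻¹ * Φ.collisionalTransferFunctional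
        (fun (i j : Fin (N + 1)) (pre post : Config (N + 1) (Fin 3) T3) =>
          2⁻¹ * (Torus.fderiv ψ (post i).1 ((Torus.geometry (Fin 3)).sepVec (post i).1 (post j).1) *
            ((‖(post i).2‖ ^ 2 - ‖(pre i).2‖ ^ 2) / 2))) (Φ.flow t₁ z) (t₂ - t₁) ∂G :=
    fun y => integral_avg_contactEnergyCurrent_shift_eq a θ u Φ ψ y h₁ h₁₂
  -- Step 2: joint integrability on `𝕋³ × Config`
  have hae : ∀ᵐ p ∂((volume : Measure T3).prod G), p.2 ∈ Φ.good :=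
    (Measure.quasiMeasurePreserving_snd (μ := (volume : Measure T3)) (ν := G)).ae hgood
  have hFint : Integrable (Function.uncurry fun (y : T3) (z : Config (N + 1) (Fin 3) T3) =>
      ((N + 1 : ℕ) : ℝ)⁻¹ * Φ.collisionalTransferFunctional
        (fun (i j : Fin (N + 1)) (pre post : Config (N + 1) (Fin 3) T3) =>
          2⁻¹ * (Torus.fderiv (fun x => ψ (x + y)) (post i).1
            ((Torus.geometry (Fin 3)).sepVec (post i).1 (post j).1) *
            ((‖(post i).2‖ ^ 2 - ‖(pre i).2‖ ^ 2) / 2))) (Φ.flow t₁ z) (t₂ - t₁))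
      ((volume : Measure T3).prod G) := by
    have hsm := stronglyMeasurable_contactEnergyFunctional_shift hε Φ hψ (t₂ - t₁)
    have hmeas : Measurable fun p : T3 × Config (N + 1) (Fin 3) T3 => (p.1, Φ.flow t₁ p.2) :=
      measurable_fst.prodMk ((Φ.measurable_flow t₁).comp measurable_snd)
    have hFm := (((hsm.comp_measurable hmeas).const_mul
      (((N + 1 : ℕ) : ℝ)⁻¹)).aestronglyMeasurable (μ := (volume : Measure T3).prod G)).congr
      (by
        filter_upwards [hae] with p hp
        simp only [Function.comp_apply, Function.uncurry_def]
        rw [indicator_of_mem (Φ.mapsTo_good t₁ hp)])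
    refine Integrable.mono' ((hQ.comp_snd (volume : Measure T3)).const_mul
      (L / 2 + C * hsDiameter σ N / 4)) hFm ?_
    filter_upwards [hae] with p hp
    simp only [Function.uncurry_def]
    have hzg : Φ.flow t₁ p.2 ∈ Φ.good := Φ.mapsTo_good t₁ hp
    have hW := abs_energyTransfer_le (Φ.isTrajectory _ hzg)
      (norm_sub_le_of_fderiv_le (h1y p.1) (hLy p.1)) 0 (t₂ - t₁)
    change |Φ.energyTransfer (fun x => ψ (x + p.1)) (Φ.flow t₁ p.2) (t₂ - t₁)| ≤
      L * hsDiameter σ N * (2⁻¹ * Φ.collisionalTransferFunctional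
        (fun (i _j : Fin (N + 1)) (pre post : Config (N + 1) (Fin 3) T3) =>
          |‖(post i).2‖ ^ 2 - ‖(pre i).2‖ ^ 2| / 2) (Φ.flow t₁ p.2) (t₂ - t₁)) at hW
    have hR := abs_energyTransfer_flow_sub_contact_le Φ hε (h2y p.1) (hCy p.1) hp t₁ (t₂ - t₁)
    set S := Φ.collisionalTransferFunctional
        (fun (i j : Fin (N + 1)) (pre post : Config (N + 1) (Fin 3) T3) =>
          2⁻¹ * (Torus.fderiv (fun x => ψ (x + p.1)) (post i).1
            ((Torus.geometry (Fin 3)).sepVec (post i).1 (post j).1) *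
            ((‖(post i).2‖ ^ 2 - ‖(pre i).2‖ ^ 2) / 2))) (Φ.flow t₁ p.2) (t₂ - t₁) with hS
    set W := Φ.energyTransfer (fun x => ψ (x + p.1)) (Φ.flow t₁ p.2) (t₂ - t₁) with hWdef
    set A := Φ.collisionalTransferFunctional
        (fun (i _j : Fin (N + 1)) (pre post : Config (N + 1) (Fin 3) T3) =>
          |‖(post i).2‖ ^ 2 - ‖(pre i).2‖ ^ 2| / 2) (Φ.flow t₁ p.2) (t₂ - t₁) with hA
    have h3 := abs_sub_abs_le_abs_sub S W
    rw [abs_sub_comm] at h3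
    rw [Real.norm_eq_abs, abs_mul, abs_of_nonneg hc0]
    calc ((N + 1 : ℕ) : ℝ)⁻¹ * |S|
        ≤ ((N + 1 : ℕ) : ℝ)⁻¹ * (L * hsDiameter σ N * (2⁻¹ * A) +
            C * hsDiameter σ N ^ 2 * (4⁻¹ * A)) :=
          mul_le_mul_of_nonneg_left (by linarith) hc0
      _ = (L / 2 + C * hsDiameter σ N / 4) * (hsDiameter σ N * ((N + 1 : ℕ) : ℝ)⁻¹ * A) := by ring
  -- Step 3: average over the shift, one Fubini, and the vanishing `y`-average
  calc _ = ∫ _y : T3, ∫ z, ((N + 1 : ℕ) : ℝ)⁻¹ * Φ.collisionalTransferFunctional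
        (fun (i j : Fin (N + 1)) (pre post : Config (N + 1) (Fin 3) T3) =>
          2⁻¹ * (Torus.fderiv ψ (post i).1 ((Torus.geometry (Fin 3)).sepVec (post i).1 (post j).1) *
            ((‖(post i).2‖ ^ 2 - ‖(pre i).2‖ ^ 2) / 2))) (Φ.flow t₁ z) (t₂ - t₁) ∂G := by
        rw [integral_const, probReal_univ, one_smul]
    _ = ∫ y : T3, ∫ z, ((N + 1 : ℕ) : ℝ)⁻¹ * Φ.collisionalTransferFunctional
        (fun (i j : Fin (N + 1)) (pre post : Config (N + 1) (Fin 3) T3) =>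
          2⁻¹ * (Torus.fderiv (fun x => ψ (x + y)) (post i).1
            ((Torus.geometry (Fin 3)).sepVec (post i).1 (post j).1) *
            ((‖(post i).2‖ ^ 2 - ‖(pre i).2‖ ^ 2) / 2))) (Φ.flow t₁ z) (t₂ - t₁) ∂G :=
        integral_congr_ae (ae_of_all _ fun y => (hshift y).symm)
    _ = ∫ z, (∫ y : T3, ((N + 1 : ℕ) : ℝ)⁻¹ * Φ.collisionalTransferFunctional
        (fun (i j : Fin (N + 1)) (pre post : Config (N + 1) (Fin 3) T3) =>
          2⁻¹ * (Torus.fderiv (fun x => ψ (x + y)) (post i).1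
            ((Torus.geometry (Fin 3)).sepVec (post i).1 (post j).1) *
            ((‖(post i).2‖ ^ 2 - ‖(pre i).2‖ ^ 2) / 2))) (Φ.flow t₁ z) (t₂ - t₁)) ∂G :=
        integral_integral_swap hFint
    _ = ∫ _z, (0 : ℝ) ∂G := by
        refine integral_congr_ae ?_
        filter_upwards [hgood] with z hz
        rw [integral_const_mul, integral_contactEnergyFunctional_shift_eq_zero Φ hψ
          (Φ.mapsTo_good t₁ hz) (t₂ - t₁), mul_zero]
    _ = 0 := integral_zero _ _

end CollisionalEnergyContactClosure

/-- **Registered-stub form (CE'-eq)**: in EQUILIBRIUM (constant profiles `a, θ > 0`, `u`; `0 < σ < 1/2`;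
every `N`, every flow, `0 ≤ t₁ ≤ t₂`, smooth `ψ`) the contact energy current `c S^e_ψ ∘ Φ_{t₁}` of stub CE'
is integrable under the local Gibbs law with mean EXACTLY `0`; hence at constant profiles stub CE' is the
closure in mean of `J^e_ψ − I^e_ψ` alone. [folklore] -/
theorem stub_collisionalEnergyContactEquilibrium : ∀ (a θ : ℝ) (u : Literature.MathematicalPhysics.KineticTheory.V3), 0 < a → 0 < θ → ∀ (σ : ℝ), 0 < σ → σ < 1 / 2 → ∀ (N : ℕ) (Φ : Literature.Analysis.FluidPDE.HardSphereFlow (Literature.Analysis.FluidPDE.Torus.geometry (Fin 3)) (Literature.MathematicalPhysics.KineticTheory.hsDiameter σ N) (N + 1)) (t₁ t₂ : ℝ), 0 ≤ t₁ → t₁ ≤ t₂ → ∀ (ψ : Literature.MathematicalPhysics.KineticTheory.T3 → ℝ), Literature.Analysis.FunctionSpaces.Torus.IsSmooth ψ → MeasureTheory.Integrable (fun z => ((N + 1 : ℕ) : ℝ)⁻¹ * Φ.collisionalTransferFunctional (fun (i j : Fin (N + 1)) (pre post : Literature.Analysis.FluidPDE.Config (N + 1) (Fin 3) Literature.MathematicalPhysics.KineticTheory.T3)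 => 2⁻¹ * (Literature.Analysis.FunctionSpaces.Torus.fderiv ψ (post i).1 ((Literature.Analysis.FluidPDE.Torus.geometry (Fin 3)).sepVec (post i).1 (post j).1) * ((‖(post i).2‖ ^ 2 - ‖(pre i).2‖ ^ 2) / 2))) (Φ.flow t₁ z) (t₂ - t₁)) (Literature.MathematicalPhysics.KineticTheory.localGibbsLaw σ (fun _ => a) (fun _ => u) (fun _ => θ) N Φ) ∧ ∫ z, ((N + 1 : ℕ) : ℝ)⁻¹ * Φ.collisionalTransferFunctional (fun (i j : Fin (N + 1)) (pre post : Literature.Analysis.FluidPDE.Config (N + 1) (Fin 3) Literature.MathematicalPhysics.KineticTheory.T3) => 2⁻¹ * (Literature.Analysis.FunctionSpaces.Torus.fderiv ψ (post i).1 ((Literature.Analysis.FluidPDE.Torus.geometry (Fin 3)).sepVec (post i).1 (post j).1) * ((‖(post i).2‖ ^ 2 - ‖(pre i).2‖ ^ 2) / 2))) (Φ.flow t₁ z) (t₂ - t₁) ∂Literature.MathematicalPhysics.KineticTheory.localGibbsLaw σ (fun _ => a) (fun _ => u) (fun _ => θ) N Φ = 0 :=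
  fun _a _θ u ha hθ _σ hσ hσ2 _N Φ _t₁ _t₂ h₁ h₁₂ _ψ hψ =>
    ⟨CollisionalEnergyContactClosure.integrable_avg_contactEnergyCurrent_flow' continuous_const
        continuous_const continuous_const (fun _ => ha) (fun _ => hθ) hσ hσ2 Φ
        (hψ.isContDiff (WithTop.coe_le_coe.2 le_top)) h₁ h₁₂,
      CollisionalEnergyContactClosure.integral_avg_contactEnergyCurrent_eq_zero_const hσ hσ2 ha hθ u Φ
        hψ h₁ h₁₂⟩

end Summit.AtomisticToContinuum.HydrodynamicLimit.Theorems

end
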